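import Mathlib
import Summits.ResolutionOfSingularities.ResolutionOfSingularities.Theorems.WCut
import Literature.AlgebraicGeometry.Resolution.PerronTransforms
import Literature.AlgebraicGeometry.Resolution.LocalUniformization
import Literature.AlgebraicGeometry.Resolution.RankOneReduction
import Literature.AlgebraicGeometry.Resolution.RankOneReductionProofs
import Literature.AlgebraicGeometry.Resolution.AffineModelLU
import Literature.AlgebraicGeometry.Resolution.AffineDomainDimension
import Literature.AlgebraicGeometry.Resolution.AffineDomainEquidim
import Literature.AlgebraicGeometry.Resolution.MuPTorsorLocalUniformizationRelative
import HarnessLib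

/-!
# KeyChainLU — decomp-res node «KeyLadder» (lens-1 g21), tree file 1/5: key-chain local uniformization

Content VERBATIM from the decomp-res lens-1 g21 tree companion `HOME/decomp-res-lens-1/g21/tree/KeyChainLU.lean`
(sha 0edd4007, 1 331 l; = the node
`g21/KeyLadder.lean` a1145436 re-namespaced, typed against the LANDED `Theorems.WCut`, nothing inlined; farm rc 0 ·
0 err · 0 warn · 0 sorry, axioms
standard; HOME = run/shared/lean/pub/decomp-res).  Critic: CRITIC-LEDGER row 163 (DECIDED +1 · MAP 0: the kernel law
`relLU_of_keyChainTop`, cell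
`KeyChainTopBelow`, exact cuts of both `W`-halves; 2026-08-31T01:02:09Z); landing orders INBOX :625 / :633,
`g21/WRITER.md` 82b559ef.  Landed by
decomp-res writer g9 for the lens-1 column (host route `Valuative`, item `LuAlphaPTorsor` stmt-…-0641 — HELPER
files, no route edit) as
`KeyChainLU` / `KeyChainLU2` / … (PARTS I–VI, greedy ≤ 400-line packing, linear imports) and `KeyChainCut` (PART
VII, the split point named in
WRITER.md); namespace, sections, section variables / opens and every declaration exactly as in the companion (its
one global linter option dropped).

## The node (companion header VERBATIM)

# Key-chain local uniformization (decomp-res lens-1, gen 21)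

Hypothesis-free relative local uniformization for valued function fields carrying an INDUCTIVE BINOMIAL KEY
CHAIN OVER A MONOMIAL 3-FRAME (`KeyChainTopBelow k O`, PART II), and the exact cut of the true residual
`KaplanskyLadder.NonKHToricArchLU e c n` (and of its two `W`-halves, `WCut`) along that cell, with the root
closures `closes_key` / `closes_wkey` through `DefectlessLadder.closes_sigma`.

* PART I   Laurent-monomial calculus over a sequence `g : ℕ → K` (`mon`, `Bdd`, value lattices).
* PART II  the datum `IsKeyChain k O g e b ζ` / the cell `KeyChainTopBelow k O` (MacLane–Vaquié key polynomials in
           binomial form, San Saturnino completeness [arXiv:1412.7697, Def. 4.1] as a first-order field).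
* PART III LEMMA U: value-`1` monomials are monomials in the units `Z_j = s_j ^ e_j / 𝔪_j`.
* PART IV  the Perron–Zariski chart adapted to a finite list of monomials (`Literature…PerronTransforms`).
* PART V   the regular model `k[Y′, Z^{±1}]` of dimension `4` and its centre.
* PART VI  the law `relLU_of_keyChainTop : KeyChainTopBelow k O → RelLocalUniformization k K O`.
* PART VII the cut `nonKHToricArchLU_iff_key`, the `W`-half re-locations, `closes_key`, `closes_wkey`,
           `root_iff_key_sigma` (ROOT BY NAME).

0 sorry; axioms `[propext, Classical.choice, Quot.sound]`.  Source node and probes: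
`run/shared/lean/pub/decomp-res/decomp-res-lens-1/g21/{KeyLadder.lean, bc/Probe.lean, NODE-g21.md}`.

-/

noncomputable section

open IsLocalRing Literature.AlgebraicGeometry.Resolution
open Summit.ResolutionOfSingularities.ResolutionOfSingularities.Theorems

namespace Summit.ResolutionOfSingularities.ResolutionOfSingularities.Theorems.KeyChainLU

section Monomials

variable {K : Type} [Field K]

/-! ## PART I — Laurent monomial calculus in a sequence `g : ℕ → K` (§1) -/

/-- The Laurent monomial `g ^ β := ∏ i ∈ β.support, g i ^ β i`. -/
def mon (g : ℕ → K) (β : ℕ →₀ ℤ) : K := β.prod fun i m => g i ^ m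

/-- «`β` lives at level `N`»: all indices occurring in `β` are `< N`. -/
def Bdd (N : ℕ) (β : ℕ →₀ ℤ) : Prop := ∀ i ∈ β.support, i < N

variable {g : ℕ → K}

/-- `mon_zero_index`: Auxiliary step of the key-chain calculus, VERBATIM from the lens-1 g21 companion (see the
module docstring); the statement is its type. [folklore] -/
theorem mon_zero_index (g : ℕ → K) : mon g 0 = 1 := Finsupp.prod_zero_index

/-- `mon_add`: Auxiliary step of the key-chain calculus, VERBATIM from the lens-1 g21 companion (see the module
docstring); the statement is its type. [folklore] -/
theorem mon_add (hg : ∀ i, g i ≠ 0) (β γ : ℕ →₀ ℤ) : mon g (β + γ) = mon g β * mon g γ :=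
  Finsupp.prod_add_index' (fun i => zpow_zero (g i)) fun i m n => zpow_add₀ (hg i) m n

/-- `mon_single`: Auxiliary step of the key-chain calculus, VERBATIM from the lens-1 g21 companion (see the module
docstring); the statement is its type. [folklore] -/
theorem mon_single (g : ℕ → K) (i : ℕ) (m : ℤ) : mon g (Finsupp.single i m) = g i ^ m :=
  Finsupp.prod_single_index (zpow_zero _)

/-- `mon_ne_zero`: Auxiliary step of the key-chain calculus, VERBATIM from the lens-1 g21 companion (see the module
docstring); the statement is its type. [folklore] -/
theorem mon_ne_zero (hg : ∀ i, g i ≠ 0) (β : ℕ →₀ ℤ) : mon g β ≠ 0 :=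
  Finset.prod_ne_zero_iff.mpr fun i _ => zpow_ne_zero _ (hg i)

/-- `mon_neg`: Auxiliary step of the key-chain calculus, VERBATIM from the lens-1 g21 companion (see the module
docstring); the statement is its type. [folklore] -/
theorem mon_neg (hg : ∀ i, g i ≠ 0) (β : ℕ →₀ ℤ) : mon g (-β) = (mon g β)⁻¹ := by
  have h := mon_add hg β (-β)
  rw [add_neg_cancel, mon_zero_index] at h
  exact eq_inv_of_mul_eq_one_right h.symm

/-- `mon_sub`: Auxiliary step of the key-chain calculus, VERBATIM from the lens-1 g21 companion (see the module
docstring); the statement is its type. [folklore] -/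
theorem mon_sub (hg : ∀ i, g i ≠ 0) (β γ : ℕ →₀ ℤ) : mon g (β - γ) = mon g β / mon g γ := by
  rw [sub_eq_add_neg, mon_add hg, mon_neg hg, div_eq_mul_inv]

/-- `mon_intSMul`: Auxiliary step of the key-chain calculus, VERBATIM from the lens-1 g21 companion (see the module
docstring); the statement is its type. [folklore] -/
theorem mon_intSMul (hg : ∀ i, g i ≠ 0) (c : ℤ) (β : ℕ →₀ ℤ) : mon g (c • β) = mon g β ^ c := by
  induction c using Int.induction_on with
  | zero => rw [zero_smul, mon_zero_index, zpow_zero]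
  | succ n ih => rw [add_smul, one_smul, mon_add hg, ih, zpow_add_one₀ (mon_ne_zero hg β)]
  | pred n ih =>
    rw [sub_smul, one_smul, mon_sub hg, ih, zpow_sub_one₀ (mon_ne_zero hg β), div_eq_mul_inv]

/-- `mon_finset_sum`: Auxiliary step of the key-chain calculus, VERBATIM from the lens-1 g21 companion (see the
module docstring); the statement is its type. [folklore] -/
theorem mon_finset_sum (hg : ∀ i, g i ≠ 0) {ι : Type} (s : Finset ι) (β : ι → ℕ →₀ ℤ) :
    mon g (∑ t ∈ s, β t) = ∏ t ∈ s, mon g (β t) := by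
  classical
  induction s using Finset.induction_on with
  | empty => rw [Finset.sum_empty, Finset.prod_empty, mon_zero_index]
  | insert a s ha ih => rw [Finset.sum_insert ha, Finset.prod_insert ha, mon_add hg, ih]

/-- `valuation_mon`: Auxiliary step of the key-chain calculus, VERBATIM from the lens-1 g21 companion (see the
module docstring); the statement is its type. [folklore] -/
theorem valuation_mon (O : ValuationSubring K) (g : ℕ → K) (β : ℕ →₀ ℤ) :
    O.valuation (mon g β) = β.prod fun i m => O.valuation (g i) ^ m := by
  show O.valuation (∏ i ∈ β.support, g i ^ β i) = ∏ i ∈ β.support, O.valuation (g i) ^ β i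
  rw [map_prod]
  simp_rw [map_zpow₀]

/-! ### levels -/

/-- `bdd_mono`: Auxiliary step of the key-chain calculus, VERBATIM from the lens-1 g21 companion (see the module
docstring); the statement is its type. [folklore] -/
theorem bdd_mono {M N : ℕ} (h : M ≤ N) {β : ℕ →₀ ℤ} (hβ : Bdd M β) : Bdd N β :=
  fun i hi => lt_of_lt_of_le (hβ i hi) h

/-- `bdd_zero`: Auxiliary step of the key-chain calculus, VERBATIM from the lens-1 g21 companion (see the module
docstring); the statement is its type. [folklore] -/
theorem bdd_zero (N : ℕ) : Bdd N (0 : ℕ →₀ ℤ) := fun i hi => by simp at hi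

/-- `bdd_add`: Auxiliary step of the key-chain calculus, VERBATIM from the lens-1 g21 companion (see the module
docstring); the statement is its type. [folklore] -/
theorem bdd_add {N : ℕ} {β γ : ℕ →₀ ℤ} (hβ : Bdd N β) (hγ : Bdd N γ) : Bdd N (β + γ) := by
  classical
  intro i hi
  rcases Finset.mem_union.mp (Finsupp.support_add hi) with h | h
  · exact hβ i h
  · exact hγ i h

/-- `bdd_neg`: Auxiliary step of the key-chain calculus, VERBATIM from the lens-1 g21 companion (see the module
docstring); the statement is its type. [folklore] -/
theorem bdd_neg {N : ℕ} {β : ℕ →₀ ℤ} (hβ : Bdd N β) : Bdd N (-β) := fun i hi => by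
  rw [Finsupp.support_neg] at hi
  exact hβ i hi

/-- `bdd_sub`: Auxiliary step of the key-chain calculus, VERBATIM from the lens-1 g21 companion (see the module
docstring); the statement is its type. [folklore] -/
theorem bdd_sub {N : ℕ} {β γ : ℕ →₀ ℤ} (hβ : Bdd N β) (hγ : Bdd N γ) : Bdd N (β - γ) := by
  rw [sub_eq_add_neg]
  exact bdd_add hβ (bdd_neg hγ)

/-- `bdd_intSMul`: Auxiliary step of the key-chain calculus, VERBATIM from the lens-1 g21 companion (see the module
docstring); the statement is its type. [folklore] -/
theorem bdd_intSMul {N : ℕ} (c : ℤ) {β : ℕ →₀ ℤ} (hβ : Bdd N β) : Bdd N (c • β) :=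
  fun i hi => hβ i (Finsupp.support_smul hi)

/-- `bdd_single`: Auxiliary step of the key-chain calculus, VERBATIM from the lens-1 g21 companion (see the module
docstring); the statement is its type. [folklore] -/
theorem bdd_single {N i : ℕ} (hi : i < N) (m : ℤ) : Bdd N (Finsupp.single i m) := fun j hj => by
  classical
  have := Finsupp.support_single_subset hj
  rw [Finset.mem_singleton] at this
  exact this ▸ hi

/-- `bdd_finset_sum`: Auxiliary step of the key-chain calculus, VERBATIM from the lens-1 g21 companion (see the
module docstring); the statement is its type. [folklore] -/
theorem bdd_finset_sum {N : ℕ} {ι : Type} (s : Finset ι) {β : ι → ℕ →₀ ℤ}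
    (hβ : ∀ t ∈ s, Bdd N (β t)) : Bdd N (∑ t ∈ s, β t) := by
  classical
  induction s using Finset.induction_on with
  | empty => rw [Finset.sum_empty]; exact bdd_zero N
  | insert a s ha ih =>
    rw [Finset.sum_insert ha]
    exact bdd_add (hβ a (Finset.mem_insert_self a s))
      (ih fun t ht => hβ t (Finset.mem_insert_of_mem ht))

/-- A monomial at level `N`, written as a product over `Fin N`. [folklore] -/
theorem valuation_mon_eq_prod_fin (O : ValuationSubring K) (g : ℕ → K) {N : ℕ} {β : ℕ →₀ ℤ}
    (hβ : Bdd N β) : O.valuation (mon g β) = ∏ i : Fin N, O.valuation (g i) ^ β i := by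
  rw [valuation_mon, Finsupp.prod_of_support_subset β (s := Finset.range N)
    (fun i hi => Finset.mem_range.mpr (hβ i hi)) _ (fun i _ => zpow_zero _)]
  exact Finset.prod_range fun i => O.valuation (g i) ^ β i

variable (O : ValuationSubring K)

/-! ### the value homomorphism `ℓ : (ℕ →₀ ℤ) →+ Additive Γˣ` -/

/-- The value of a non-zero element as a unit of the value group, written additively. -/
def uval (x : K) (hx : x ≠ 0) : Additive (O.ValueGroup)ˣ :=
  Additive.ofMul (Units.mk0 (O.valuation x) ((Valuation.ne_zero_iff O.valuation).mpr hx))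

/-- `val_toMul_uval`: Auxiliary step of the key-chain calculus, VERBATIM from the lens-1 g21 companion (see the
module docstring); the statement is its type. [folklore] -/
@[simp] theorem val_toMul_uval (x : K) (hx : x ≠ 0) :
    ((Additive.toMul (uval O x hx) : (O.ValueGroup)ˣ) : O.ValueGroup) = O.valuation x := rfl

/-- `uval_eq_iff`: Auxiliary step of the key-chain calculus, VERBATIM from the lens-1 g21 companion (see the module
docstring); the statement is its type. [folklore] -/
theorem uval_eq_iff {x y : K} (hx : x ≠ 0) (hy : y ≠ 0) :
    uval O x hx = uval O y hy ↔ O.valuation x = O.valuation y := by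
  constructor
  · intro h
    have := congrArg (fun u : Additive (O.ValueGroup)ˣ => ((Additive.toMul u : (O.ValueGroup)ˣ) :
      O.ValueGroup)) h
    simpa using this
  · intro h
    apply Additive.toMul.injective
    ext
    simpa using h

/-- `uval_mul`: Auxiliary step of the key-chain calculus, VERBATIM from the lens-1 g21 companion (see the module
docstring); the statement is its type. [folklore] -/
theorem uval_mul {x y : K} (hx : x ≠ 0) (hy : y ≠ 0) :
    uval O (x * y) (mul_ne_zero hx hy) = uval O x hx + uval O y hy := by
  apply Additive.toMul.injective
  ext
  simp [uval, toMul_add]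

/-- `uval_one`: Auxiliary step of the key-chain calculus, VERBATIM from the lens-1 g21 companion (see the module
docstring); the statement is its type. [folklore] -/
theorem uval_one : uval O (1 : K) one_ne_zero = 0 := by
  apply Additive.toMul.injective
  ext
  simp [uval]

/-- `uval_zpow`: Auxiliary step of the key-chain calculus, VERBATIM from the lens-1 g21 companion (see the module
docstring); the statement is its type. [folklore] -/
theorem uval_zpow {x : K} (hx : x ≠ 0) (n : ℤ) :
    uval O (x ^ n) (zpow_ne_zero n hx) = n • uval O x hx := by
  apply Additive.toMul.injective
  ext
  simp [uval, Units.val_zpow_eq_zpow_val]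

/-- `toMul_uval_le_one_iff`: Auxiliary step of the key-chain calculus, VERBATIM from the lens-1 g21 companion (see
the module docstring); the statement is its type. [folklore] -/
theorem toMul_uval_le_one_iff {x : K} (hx : x ≠ 0) :
    Additive.toMul (uval O x hx) ≤ 1 ↔ O.valuation x ≤ 1 := by
  rw [← Units.val_le_val]; simp

/-- `toMul_uval_lt_one_iff`: Auxiliary step of the key-chain calculus, VERBATIM from the lens-1 g21 companion (see
the module docstring); the statement is its type. [folklore] -/
theorem toMul_uval_lt_one_iff {x : K} (hx : x ≠ 0) :
    Additive.toMul (uval O x hx) < 1 ↔ O.valuation x < 1 := by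
  rw [← Units.val_lt_val]; simp

/-- `uval_eq_zero_iff`: Auxiliary step of the key-chain calculus, VERBATIM from the lens-1 g21 companion (see the
module docstring); the statement is its type. [folklore] -/
theorem uval_eq_zero_iff {x : K} (hx : x ≠ 0) : uval O x hx = 0 ↔ O.valuation x = 1 := by
  rw [← uval_one O, uval_eq_iff, map_one]

variable {O}

/-- The value homomorphism on exponent vectors. -/
def ell (O : ValuationSubring K) (g : ℕ → K) (hg : ∀ i, g i ≠ 0) :
    (ℕ →₀ ℤ) →+ Additive (O.ValueGroup)ˣ where
  toFun β := uval O (mon g β) (mon_ne_zero hg β)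
  map_zero' := by
    have : uval O (mon g 0) (mon_ne_zero hg 0) = uval O 1 one_ne_zero :=
      (uval_eq_iff O _ _).mpr (by rw [mon_zero_index])
    rw [this, uval_one]
  map_add' β γ := by
    have : uval O (mon g (β + γ)) (mon_ne_zero hg _) =
        uval O (mon g β * mon g γ) (mul_ne_zero (mon_ne_zero hg β) (mon_ne_zero hg γ)) :=
      (uval_eq_iff O _ _).mpr (by rw [mon_add hg])
    rw [this, uval_mul]

/-- `ell_apply`: Auxiliary step of the key-chain calculus, VERBATIM from the lens-1 g21 companion (see the module
docstring); the statement is its type. [folklore] -/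
theorem ell_apply (hg : ∀ i, g i ≠ 0) (β : ℕ →₀ ℤ) :
    ell O g hg β = uval O (mon g β) (mon_ne_zero hg β) := rfl

/-- `ell_single`: Auxiliary step of the key-chain calculus, VERBATIM from the lens-1 g21 companion (see the module
docstring); the statement is its type. [folklore] -/
theorem ell_single (hg : ∀ i, g i ≠ 0) (i : ℕ) (m : ℤ) :
    ell O g hg (Finsupp.single i m) = m • uval O (g i) (hg i) := by
  rw [ell_apply, ← uval_zpow O (hg i) m, uval_eq_iff, mon_single]

/-- `ell_eq_zero_iff`: Auxiliary step of the key-chain calculus, VERBATIM from the lens-1 g21 companion (see the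
module docstring); the statement is its type. [folklore] -/
theorem ell_eq_zero_iff (hg : ∀ i, g i ≠ 0) (β : ℕ →₀ ℤ) :
    ell O g hg β = 0 ↔ O.valuation (mon g β) = 1 := by
  rw [ell_apply, uval_eq_zero_iff]

/-- `toMul_ell_le_one_iff`: Auxiliary step of the key-chain calculus, VERBATIM from the lens-1 g21 companion (see
the module docstring); the statement is its type. [folklore] -/
theorem toMul_ell_le_one_iff (hg : ∀ i, g i ≠ 0) (β : ℕ →₀ ℤ) :
    Additive.toMul (ell O g hg β) ≤ 1 ↔ O.valuation (mon g β) ≤ 1 := by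
  rw [ell_apply, toMul_uval_le_one_iff]

/-- `toMul_ell_lt_one_iff`: Auxiliary step of the key-chain calculus, VERBATIM from the lens-1 g21 companion (see
the module docstring); the statement is its type. [folklore] -/
theorem toMul_ell_lt_one_iff (hg : ∀ i, g i ≠ 0) (β : ℕ →₀ ℤ) :
    Additive.toMul (ell O g hg β) < 1 ↔ O.valuation (mon g β) < 1 := by
  rw [ell_apply, toMul_uval_lt_one_iff]

/-- The value lattice of level `N`: the `ℤ`-span of the values of `g 0, …, g (N-1)`. -/
def VL (O : ValuationSubring K) (g : ℕ → K) (hg : ∀ i, g i ≠ 0) (N : ℕ) :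
    Submodule ℤ (Additive (O.ValueGroup)ˣ) :=
  Submodule.span ℤ (Set.range fun i : Fin N => uval O (g i) (hg i))

/-- `ell_eq_sum`: Auxiliary step of the key-chain calculus, VERBATIM from the lens-1 g21 companion (see the module
docstring); the statement is its type. [folklore] -/
theorem ell_eq_sum (hg : ∀ i, g i ≠ 0) {N : ℕ} {β : ℕ →₀ ℤ} (hβ : Bdd N β) :
    ell O g hg β = ∑ i : Fin N, β i • uval O (g i) (hg i) := by
  have h1 : β = ∑ i ∈ Finset.range N, Finsupp.single i (β i) := by
    conv_lhs => rw [← Finsupp.sum_single β]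
    exact Finsupp.sum_of_support_subset β (fun i hi => Finset.mem_range.mpr (hβ i hi)) _
      (fun i _ => Finsupp.single_zero i)
  rw [h1, map_sum, Finset.sum_range (fun i => ell O g hg (Finsupp.single i (β i)))]
  refine Finset.sum_congr rfl fun i _ => ?_
  rw [ell_single]
  congr 1
  rw [← h1]

/-- `ell_mem_VL`: Auxiliary step of the key-chain calculus, VERBATIM from the lens-1 g21 companion (see the module
docstring); the statement is its type. [folklore] -/
theorem ell_mem_VL (hg : ∀ i, g i ≠ 0) {N : ℕ} {β : ℕ →₀ ℤ} (hβ : Bdd N β) :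
    ell O g hg β ∈ VL O g hg N := by
  rw [ell_eq_sum hg hβ]
  exact Submodule.sum_mem _ fun i _ => Submodule.smul_mem _ _ (Submodule.subset_span ⟨i, rfl⟩)

/-- `exists_bdd_ell_eq`: Auxiliary step of the key-chain calculus, VERBATIM from the lens-1 g21 companion (see the
module docstring); the statement is its type. [folklore] -/
theorem exists_bdd_ell_eq (hg : ∀ i, g i ≠ 0) {N : ℕ} {x : Additive (O.ValueGroup)ˣ}
    (hx : x ∈ VL O g hg N) : ∃ β : ℕ →₀ ℤ, Bdd N β ∧ ell O g hg β = x := by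
  obtain ⟨c, hc⟩ := (Submodule.mem_span_range_iff_exists_fun ℤ).mp hx
  refine ⟨∑ i : Fin N, Finsupp.single (i : ℕ) (c i), bdd_finset_sum _ fun i _ => bdd_single i.2 _, ?_⟩
  rw [map_sum, ← hc]
  exact Finset.sum_congr rfl fun i _ => by rw [ell_single]

/-- The level-`N` value lattice `VL` is a finitely generated abelian group (auxiliary instance of the key-chain
calculus, VERBATIM from the
lens-1 g21 companion). -/
instance VL.moduleFinite (hg : ∀ i, g i ≠ 0) (N : ℕ) : Module.Finite ℤ (VL O g hg N) :=
  Module.Finite.span_of_finite ℤ (Set.finite_range _)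

/-- The level-`N` value lattice `VL` is a finitely generated abelian group (auxiliary instance of the key-chain
calculus, VERBATIM from the
lens-1 g21 companion). -/
instance VL.fg (hg : ∀ i, g i ≠ 0) (N : ℕ) : AddGroup.FG (VL O g hg N) :=
  Module.Finite.iff_addGroup_fg.mp inferInstance

end Monomials

end Summit.ResolutionOfSingularities.ResolutionOfSingularities.Theorems.KeyChainLU
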